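import Summits.QuantumFields.YangMills.Theorems.PoincareLipschitzLatticeToContinuumLimit
import Summits.QuantumFields.YangMills.Theorems.PoincareLipschitzSobolevSamplingConsistencyClosed
import HarnessLib

/-!
# K2 crux `BlockLipschitzL` (stmt-QuantumFields-23533) ∕ crux `HistoryTailL` (stmt-QuantumFields-19936) — REGISTERED STUB `stub_latticeToContinuumLimit` (S2♭″) BY NAME
# (skeleton LINE 25 «CompactnessTransfer» v1.4-band A″ `Cruxes/HistoryTailL/Lines/compactness_transfer.lean` 5f6c9044e172a9d7, ideator ym-r3-idea-2 g15 13:04:16Z;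
# route-QuantumFields-PoincareLipschitz; the stub text (1e033e6a3fd7fedf) = the conclusion of ✓`PoincareLipschitzLatticeToContinuumLimit.latticeToContinuumLimit_of`
# TOKEN FOR TOKEN, its one hypothesis `hΓ5` = ✓`PoincareLipschitzSobolevSamplingConsistencyClosed.exists_unit_sample_of_sobolev_closed` (px5 g8; door ✓`…SobolevSamplingConsistency.exists_unit_sample_of_sobolev` over hB ✓px15 `hB_holds`, hC ✓w7 `bad_part_small`, hD ✓w4 `l2_row_of_sobolev`) — this file gives the
# registry its by-name inhabitant)

Cell `ym3-torus` (YM ladder rung R3 = continuum SU(2) Yang–Mills on the three-torus; NOT the Clay problem), width seat `ym3-torus-px3` gen 8 (the Γ-KNIT pen).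

WHAT THIS IS NOT.  Pure composition; the content is in `PoincareLipschitzLatticeToContinuumLimit` (Luckhaus' lemma on ℤ³: ✓(L)(M)(S)(C)(K-a)(K-b) over the bricks
(Γ2-W) ★w8, (Γ2-IBP) LEAD, (Γ2-lsc-ε) px5, ✓glue w7) and in `PoincareLipschitzSobolevSamplingConsistency` ((Γ5): Γ5b′ w7, Γ5a/Γ5-B px15, Γ5-C w7, Γ5-D w4, knit px5).
The load-bearing continuum stub `stub_uniformSmallScaleEnergy` (S1″) stays OPEN; nothing of `BlockLipschitzL`, `HistoryTailL`, the organ `hImproveCoreFlat` or the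
rung is proved.  YM₃ on T³ is rung R3, NOT the Clay problem.

References: S. Luckhaus, Indiana Univ. Math. J. 37 (1988) [Luckhaus1988]; L. Simon (1996) §2.9 [Simon1996]; R. Alicandro, M. Cicalese (2008) [AlicandroCicalese2008].
-/

noncomputable section

open MeasureTheory Filter Topology
open scoped BigOperators
open Literature.MathematicalPhysics.QuantumFieldTheory.Balaban1983to89
open Literature.MathematicalPhysics.QuantumFieldTheory.Balaban1983to89.B4Eq19LatticeOperators (Zd box unitVec)

namespace Summit.QuantumFields.YangMills.Theorems.PoincareLipschitzCompactnessTransferLatticeToContinuumLimitStub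

/-- **REGISTERED STUB `stub_latticeToContinuumLimit` (S2♭″, LINE 25 v1.4-band A″, 1e033e6a3fd7fedf), BY NAME**: the blow-down limit of an almost-minimising
bounded-energy unit lattice sequence is a `W^{1,2}` local minimiser into `S³` on the cube, and the lattice energies converge onto it from above at comparable scales —
`:= latticeToContinuumLimit_of exists_unit_sample_of_sobolev`. [cite: Luckhaus1988, Lemma 1 + Thm 2; Simon1996, §2.9 Lemma 1; AlicandroCicalese2008, Thm 4.1] -/
theorem stub_latticeToContinuumLimit :
    ∀ (Λ₀ : ℝ), 0 < Λ₀ → ∀ (u : ℕ → Zd 3 → EuclideanSpace ℝ (Fin 4)) (z : ℕ → Zd 3) (R : ℕ → ℤ),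
      (∀ k : ℕ, (k : ℝ) + 1 ≤ R k) → (∀ (k : ℕ) (y : Zd 3), ‖u k y‖ = 1) →
      (∀ k : ℕ, (∀ (z' : Zd 3) (ρ : ℤ), 0 ≤ ρ → box z' (ρ + 1) ⊆ box (z k) (R k) →
        ∀ v : Zd 3 → EuclideanSpace ℝ (Fin 4), (∀ y, y ∉ box z' ρ → v y = (u k) y) → (∀ y ∈ box z' ρ, ‖v y‖ = 1) →
        ∑ y ∈ box z' (ρ + 1), ∑ μ : Fin 3, ‖(u k) (y + unitVec μ) - (u k) y‖ ^ 2 ≤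
        (∑ y ∈ box z' (ρ + 1), ∑ μ : Fin 3, ‖v (y + unitVec μ) - v y‖ ^ 2) + (1 / ((k : ℝ) + 1)) * ((ρ : ℝ) + 1))) →
      (∀ k : ℕ, ∑ y ∈ box (z k) (R k), ∑ μ : Fin 3, ‖(u k) (y + unitVec μ) - (u k) y‖ ^ 2 ≤ Λ₀ * R k) →
      ∀ (U₀ : EuclideanSpace ℝ (Fin 3) → EuclideanSpace ℝ (Fin 4)) (φ₀ : ℕ → ℕ), StrictMono φ₀ →
      AEStronglyMeasurable U₀ (volume.restrict {x : EuclideanSpace ℝ (Fin 3) | ∀ i : Fin 3, |x i| < 1}) →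
      (∀ᵐ x ∂(volume.restrict {x : EuclideanSpace ℝ (Fin 3) | ∀ i : Fin 3, |x i| < 1}), ‖U₀ x‖ = 1) →
      Tendsto (fun k : ℕ => ∫ x in {x : EuclideanSpace ℝ (Fin 3) | ∀ i : Fin 3, |x i| < 1},
            ‖u (φ₀ k) (z (φ₀ k) + fun i => ⌊(R (φ₀ k) : ℝ) * x i⌋) - U₀ x‖ ^ 2) atTop (𝓝 0) →
      (∀ (m : ℕ) (j : Fin 3 → Fin (2 ^ m)) (μ : Fin 3), ∃ g : EuclideanSpace ℝ (Fin 4),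
          Tendsto (fun k : ℕ => ∫ x in {x : EuclideanSpace ℝ (Fin 3) |
                ∀ i : Fin 3, (-1 : ℝ) + 2 * (j i : ℕ) / (2 : ℝ) ^ m ≤ x i ∧ x i < (-1 : ℝ) + 2 * ((j i : ℕ) + 1) / (2 : ℝ) ^ m},
              (R (φ₀ k) : ℝ) • (u (φ₀ k) ((z (φ₀ k) + fun i => ⌊(R (φ₀ k) : ℝ) * x i⌋) + unitVec μ)
                - u (φ₀ k) (z (φ₀ k) + fun i => ⌊(R (φ₀ k) : ℝ) * x i⌋))) atTop (𝓝 g)) →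
      ∀ (hQ : IsOpen {x : EuclideanSpace ℝ (Fin 3) | ∀ i : Fin 3, |x i| < 1}), ∃ (U : EuclideanSpace ℝ (Fin 3) → EuclideanSpace ℝ (Fin 4)) (G : EuclideanSpace ℝ (Fin 3) → (EuclideanSpace ℝ (Fin 3) →L[ℝ] EuclideanSpace ℝ (Fin 4))) (φ : ℕ → ℕ),
      StrictMono φ ∧ (∃ ψ : ℕ → ℕ, StrictMono ψ ∧ ∀ k : ℕ, φ k = φ₀ (ψ k)) ∧
      (∀ᵐ x ∂(volume.restrict {x : EuclideanSpace ℝ (Fin 3) | ∀ i : Fin 3, |x i| < 1}), U x = U₀ x) ∧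
      Literature.Analysis.FunctionSpaces.HasWeakFDerivOn ⟨{x : EuclideanSpace ℝ (Fin 3) | ∀ i : Fin 3, |x i| < 1}, hQ⟩ volume U G ∧
      (∀ x : EuclideanSpace ℝ (Fin 3), (∀ i : Fin 3, |x i| < 1) → ‖U x‖ = 1) ∧
      MeasureTheory.IntegrableOn (fun x => ∑ i : Fin 3, ‖G x (EuclideanSpace.single i (1:ℝ))‖ ^ 2)
        {x : EuclideanSpace ℝ (Fin 3) | ∀ i : Fin 3, |x i| < 1} ∧
      (∀ (V : EuclideanSpace ℝ (Fin 3) → EuclideanSpace ℝ (Fin 4)) (GV : EuclideanSpace ℝ (Fin 3) → (EuclideanSpace ℝ (Fin 3) →L[ℝ] EuclideanSpace ℝ (Fin 4))) (s : ℝ), s < 1 →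
        Literature.Analysis.FunctionSpaces.HasWeakFDerivOn ⟨{x : EuclideanSpace ℝ (Fin 3) | ∀ i : Fin 3, |x i| < 1}, hQ⟩ volume V GV →
        (∀ x : EuclideanSpace ℝ (Fin 3), (∀ i : Fin 3, |x i| < 1) → ‖V x‖ = 1) →
        MeasureTheory.IntegrableOn (fun x => ∑ i : Fin 3, ‖GV x (EuclideanSpace.single i (1:ℝ))‖ ^ 2)
        {x : EuclideanSpace ℝ (Fin 3) | ∀ i : Fin 3, |x i| < 1} →
        (∀ x : EuclideanSpace ℝ (Fin 3), (∃ i : Fin 3, s ≤ |x i|) → V x = U x) →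
        ∫ x in {x : EuclideanSpace ℝ (Fin 3) | ∀ i : Fin 3, |x i| < 1}, ∑ i : Fin 3, ‖G x (EuclideanSpace.single i (1:ℝ))‖ ^ 2 ≤
          ∫ x in {x : EuclideanSpace ℝ (Fin 3) | ∀ i : Fin 3, |x i| < 1}, ∑ i : Fin 3, ‖GV x (EuclideanSpace.single i (1:ℝ))‖ ^ 2) ∧
      ∫ x in {x : EuclideanSpace ℝ (Fin 3) | ∀ i : Fin 3, |x i| < 1}, ∑ i : Fin 3, ‖G x (EuclideanSpace.single i (1:ℝ))‖ ^ 2 ≤ Λ₀ ∧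
      ∀ (r₀ η : ℝ), 0 < r₀ → r₀ ≤ 1 / 8 → 0 < η → ∃ r : ℝ, r₀ / 2 ≤ r ∧ r ≤ r₀ ∧ ∃ k₀ : ℕ, ∀ k : ℕ, k₀ ≤ k →
        ∃ ρ : ℤ, r * (R (φ k) : ℝ) ≤ ρ ∧ (ρ : ℝ) ≤ 2 * r * R (φ k) ∧
        ∑ y ∈ box (z (φ k)) (2 * ρ), ∑ μ : Fin 3, ‖(u (φ k)) (y + unitVec μ) - (u (φ k)) y‖ ^ 2 ≤
          (R (φ k) : ℝ) * ((∫ x in {x : EuclideanSpace ℝ (Fin 3) | ∀ i : Fin 3, |x i| < (5 * r)}, ∑ i : Fin 3, ‖G x (EuclideanSpace.single i (1:ℝ))‖ ^ 2) + η) :=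
  Summit.QuantumFields.YangMills.Theorems.PoincareLipschitzLatticeToContinuumLimit.latticeToContinuumLimit_of
    Summit.QuantumFields.YangMills.Theorems.PoincareLipschitzSobolevSamplingConsistencyClosed.exists_unit_sample_of_sobolev_closed

end Summit.QuantumFields.YangMills.Theorems.PoincareLipschitzCompactnessTransferLatticeToContinuumLimitStub

end
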